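import Summits.CriticalPhenomena.PercolationContinuityZ3.Theorems.PercNearOneGluingNoHeavyQuantLongTailTripleHubAlg
import HarnessLib

/-!
# QUANT lane R8, T-DEC: ALGEBRA OF THE LONG-TAIL QUINT HUB, PART E — the route `5lo+K → 5lo+3K` (census-1 gen 35)

builds on p205010 (kernel theorem, internal audit signed; external expert review pending)

Support file (`--supports stmt-CriticalPhenomena-4575`), QUANT lane seat prim-quant-census-1 (gen 35); memo
`run/shared/lean/prim/quant/prim-quant-census-1/g35/QUADHUB-G35.md` §5.  Theorems only, standard axioms, no sorries.  Pure real-polynomial inequalities in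
K-UNITS for the width-5 sub-floor hub `S(γ₁) ∗ ⋯ ∗ S(γ₅)` of shape `{lo, lo+K; γ}`, `2lo ≤ K ≤ 4lo`: gates `g₁..g₅ ∈ [c, 1]`, `c = lo/K ∈ [1/4, 1/2]`,
`Λ = Σgᵢ`, `S = Λ − 5c` (the maximal reduced credit), Poisson-binomial masses `u₀..u₅` of the atoms `5lo + sK` (`u_s` = probability of `s` giant pieces).
THE RULE they serve (`…QuantLongTailQuintHub`; the width-5 instance of the uniform rule `t(s) = min(⌊d⌋+2, j−1) − s` of memo §1): one low `5lo` ships to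
`5lo+2K` (`d < 1`) or `5lo+3K` (`1 ≤ d ≤ 2`); two lows (`d > 2`): `5lo → 5lo+4K`, `5lo+K → 5lo+3K`; every route cost-safe.
* `quintHub_coreE` — floor capacity of the second low `5lo+K → 5lo+3K` at the worst credit: `(Λ+5c)u₁ ≤ (5−Λ)u₃` for `S ≥ 2`, 221 products (unlike
  the width-4 analogue this one IS in the Handelman cone: the two-low regime `gᵢ ≥ c + 2/5` keeps a margin at `c = 1/2`).
Certificates: nonnegative combinations of products of the box atoms `gᵢ − c`, `1 − gᵢ`, `gᵢ − g₁`, `c − 1/4`, `1/2 − c` and the regime atoms in `S`, found by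
kit j308135 (`g35/code/kitjob3`: scipy/HiGHS float LP for the support + exact rational repair; identity re-verified in exact arithmetic) and checked here by
`linarith`.  NUMERICS (memo §5, `g35/code/exp4_quint_ineqs.py`): 0 failures on exact gate grids.

HONEST STATUS.  Algebra only; `SiblingStep`, `GluedDominatedMass`, `SDECConvClosed`, `FarTreeRow` OPEN; RATE class (log\*) / honest sentence of
`run/shared/lean/prim/quant/README.md` unchanged.  [this work].  Nothing here is cited as a published result.  The gluing rows served
[cite: KozmaNitzan2024, Conjecture 3 (p. 15)]; product measure [cite: Grimmett1999, §1.3 p. 10].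
-/

noncomputable section

namespace Summit.CriticalPhenomena.PercolationContinuityZ3.Theorems
namespace Quant
namespace LawDec

set_option maxRecDepth 8192 in
set_option maxHeartbeats 4000000 in
/-- **core (E)**: `(Λ+5c)·u₁ ≤ (5−Λ)·u₃` for `Λ ≥ 5c+2`. Degree-6 Handelman certificate, 221 products (kit j308135). [this work] -/
theorem quintHub_coreE (g₁ g₂ g₃ g₄ g₅ c : ℝ) (hc : 1 / 4 ≤ c) (h1 : c ≤ g₁) (h2 : c ≤ g₂) (h3 : c ≤ g₃) (h4 : c ≤ g₄) (h5 : c ≤ g₅) (h11 : g₁ ≤ 1) (h21 : g₂ ≤ 1) (h31 : g₃ ≤ 1) (h41 : g₄ ≤ 1) (h51 : g₅ ≤ 1) (hS2 : 5 * c + 2 ≤ g₁ + g₂ + g₃ + g₄ + g₅) :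
    ((g₁ + g₂ + g₃ + g₄ + g₅) + 5 * c) * (g₁ * (1 - g₂) * (1 - g₃) * (1 - g₄) * (1 - g₅) + g₂ * (1 - g₁) * (1 - g₃) * (1 - g₄) * (1 - g₅) + g₃ * (1 - g₁) * (1 - g₂) * (1 - g₄) * (1 - g₅) + g₄ * (1 - g₁) * (1 - g₂) * (1 - g₃) * (1 - g₅) + g₅ * (1 - g₁) * (1 - g₂) * (1 - g₃) * (1 - g₄))
      ≤ (5 - (g₁ + g₂ + g₃ + g₄ + g₅)) * (g₁ * g₂ * g₃ * (1 - g₄) * (1 - g₅) + g₁ * g₂ * g₄ * (1 - g₃) * (1 - g₅) + g₁ * g₂ * g₅ * (1 - g₃) * (1 - g₄) + g₁ * g₃ * g₄ * (1 - g₂) * (1 - g₅) + g₁ * g₃ * g₅ * (1 - g₂) * (1 - g₄) + g₁ * g₄ * g₅ * (1 - g₂) * (1 - g₃) + g₂ * g₃ * g₄ * (1 - g₁) * (1 - g₅) + g₂ * g₃ * g₅ * (1 - g₁) * (1 - g₄) + g₂ * g₄ * g₅ * (1 - g₁) * (1 - g₃) + g₃ * g₄ * g₅ * (1 - g₁) *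 (1 - g₂)) := by
  have a1 : 0 ≤ g₁ - c := sub_nonneg.2 h1
  have a2 : 0 ≤ g₂ - c := sub_nonneg.2 h2
  have a3 : 0 ≤ g₃ - c := sub_nonneg.2 h3
  have a4 : 0 ≤ g₄ - c := sub_nonneg.2 h4
  have a5 : 0 ≤ g₅ - c := sub_nonneg.2 h5
  have e1 : 0 ≤ 1 - g₁ := sub_nonneg.2 h11
  have e2 : 0 ≤ 1 - g₂ := sub_nonneg.2 h21
  have e3 : 0 ≤ 1 - g₃ := sub_nonneg.2 h31
  have e4 : 0 ≤ 1 - g₄ := sub_nonneg.2 h41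
  have e5 : 0 ≤ 1 - g₅ := sub_nonneg.2 h51
  have bl : 0 ≤ c - (1 / 4 : ℝ) := by linarith
  have s2 : 0 ≤ g₁ + g₂ + g₃ + g₄ + g₅ - 5 * c - 2 := by linarith
  linarith [mul_nonneg (mul_nonneg (mul_nonneg e4 e5) e5) bl,
    mul_nonneg (mul_nonneg (mul_nonneg e4 e4) e5) bl,
    mul_nonneg (mul_nonneg (mul_nonneg e3 e5) e5) bl,
    mul_nonneg (mul_nonneg (mul_nonneg (mul_nonneg e3 e4) e5) bl) s2,
    mul_nonneg (mul_nonneg (mul_nonneg (mul_nonneg e3 e4) e5) bl) bl,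
    mul_nonneg (mul_nonneg (mul_nonneg (mul_nonneg (mul_nonneg e3 e4) e5) bl) bl) s2,
    mul_nonneg (mul_nonneg (mul_nonneg e3 e4) e4) bl,
    mul_nonneg (mul_nonneg (mul_nonneg e3 e3) e5) bl,
    mul_nonneg (mul_nonneg (mul_nonneg e3 e3) e4) bl,
    mul_nonneg (mul_nonneg (mul_nonneg e2 e5) e5) bl,
    mul_nonneg (mul_nonneg (mul_nonneg (mul_nonneg e2 e4) e5) bl) s2,
    mul_nonneg (mul_nonneg (mul_nonneg (mul_nonneg (mul_nonneg e2 e4) e5) bl) bl) bl,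
    mul_nonneg (mul_nonneg (mul_nonneg e2 e4) e4) bl,
    mul_nonneg (mul_nonneg (mul_nonneg (mul_nonneg e2 e3) e5) bl) s2,
    mul_nonneg (mul_nonneg (mul_nonneg (mul_nonneg (mul_nonneg e2 e3) e5) bl) bl) s2,
    mul_nonneg (mul_nonneg (mul_nonneg (mul_nonneg (mul_nonneg e2 e3) e5) bl) bl) bl,
    mul_nonneg (mul_nonneg (mul_nonneg (mul_nonneg e2 e3) e4) bl) bl,
    mul_nonneg (mul_nonneg (mul_nonneg (mul_nonneg (mul_nonneg e2 e3) e4) bl) bl) s2,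
    mul_nonneg (mul_nonneg (mul_nonneg e2 e3) e3) bl,
    mul_nonneg (mul_nonneg (mul_nonneg e2 e2) e5) bl,
    mul_nonneg (mul_nonneg (mul_nonneg e2 e2) e4) bl,
    mul_nonneg (mul_nonneg (mul_nonneg e2 e2) e3) bl,
    mul_nonneg (mul_nonneg (mul_nonneg e1 e5) e5) bl,
    mul_nonneg (mul_nonneg (mul_nonneg (mul_nonneg (mul_nonneg e1 e4) e5) bl) bl) s2,
    mul_nonneg (mul_nonneg (mul_nonneg (mul_nonneg (mul_nonneg e1 e4) e5) bl) bl) bl,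
    mul_nonneg (mul_nonneg (mul_nonneg e1 e4) e4) bl,
    mul_nonneg (mul_nonneg (mul_nonneg (mul_nonneg e1 e3) e5) bl) s2,
    mul_nonneg (mul_nonneg (mul_nonneg (mul_nonneg e1 e3) e5) bl) bl,
    mul_nonneg (mul_nonneg (mul_nonneg (mul_nonneg e1 e3) e4) bl) s2,
    mul_nonneg (mul_nonneg (mul_nonneg (mul_nonneg (mul_nonneg e1 e3) e4) bl) bl) s2,
    mul_nonneg (mul_nonneg (mul_nonneg (mul_nonneg (mul_nonneg e1 e3) e4) bl) bl) bl,
    mul_nonneg (mul_nonneg (mul_nonneg e1 e3) e3) bl,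
    mul_nonneg (mul_nonneg (mul_nonneg (mul_nonneg e1 e2) e5) bl) s2,
    mul_nonneg (mul_nonneg (mul_nonneg (mul_nonneg e1 e2) e5) bl) bl,
    mul_nonneg (mul_nonneg (mul_nonneg (mul_nonneg (mul_nonneg e1 e2) e5) bl) bl) s2,
    mul_nonneg (mul_nonneg (mul_nonneg (mul_nonneg (mul_nonneg e1 e2) e5) bl) bl) bl,
    mul_nonneg (mul_nonneg (mul_nonneg (mul_nonneg e1 e2) e4) bl) s2,
    mul_nonneg (mul_nonneg (mul_nonneg (mul_nonneg (mul_nonneg e1 e2) e4) bl) bl) bl,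
    mul_nonneg (mul_nonneg (mul_nonneg (mul_nonneg e1 e2) e3) bl) s2,
    mul_nonneg (mul_nonneg (mul_nonneg (mul_nonneg e1 e2) e3) bl) bl,
    mul_nonneg (mul_nonneg (mul_nonneg (mul_nonneg e1 e2) e3) e4) e5,
    mul_nonneg (mul_nonneg (mul_nonneg (mul_nonneg (mul_nonneg e1 e2) e3) e4) e5) s2,
    mul_nonneg (mul_nonneg (mul_nonneg (mul_nonneg (mul_nonneg e1 e2) e3) e4) e5) bl,
    mul_nonneg (mul_nonneg (mul_nonneg e1 e2) e2) bl,
    mul_nonneg (mul_nonneg (mul_nonneg e1 e1) e5) bl,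
    mul_nonneg (mul_nonneg (mul_nonneg e1 e1) e4) bl,
    mul_nonneg (mul_nonneg (mul_nonneg e1 e1) e3) bl,
    mul_nonneg (mul_nonneg (mul_nonneg e1 e1) e2) bl,
    mul_nonneg (mul_nonneg (mul_nonneg a5 e3) e4) e4,
    mul_nonneg (mul_nonneg (mul_nonneg (mul_nonneg a5 e3) e4) e4) bl,
    mul_nonneg (mul_nonneg (mul_nonneg (mul_nonneg a5 e2) e3) e4) bl,
    mul_nonneg (mul_nonneg (mul_nonneg (mul_nonneg (mul_nonneg a5 e2) e3) e4) bl) s2,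
    mul_nonneg (mul_nonneg (mul_nonneg a5 e2) e3) e3,
    mul_nonneg (mul_nonneg (mul_nonneg (mul_nonneg a5 e1) e4) e4) bl,
    mul_nonneg (mul_nonneg (mul_nonneg (mul_nonneg (mul_nonneg a5 e1) e3) e4) bl) bl,
    mul_nonneg (mul_nonneg (mul_nonneg (mul_nonneg a5 e1) e3) e3) bl,
    mul_nonneg (mul_nonneg (mul_nonneg (mul_nonneg a5 e1) e2) e4) s2,
    mul_nonneg (mul_nonneg (mul_nonneg (mul_nonneg a5 e1) e2) e4) bl,
    mul_nonneg (mul_nonneg (mul_nonneg (mul_nonneg (mul_nonneg a5 e1) e2) e4) bl) s2,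
    mul_nonneg (mul_nonneg (mul_nonneg (mul_nonneg a5 e1) e2) e3) s2,
    mul_nonneg (mul_nonneg (mul_nonneg (mul_nonneg (mul_nonneg a5 e1) e2) e3) bl) bl,
    mul_nonneg (mul_nonneg (mul_nonneg a5 e1) e2) e2,
    mul_nonneg (mul_nonneg (mul_nonneg (mul_nonneg a5 e1) e1) e4) bl,
    mul_nonneg (mul_nonneg (mul_nonneg (mul_nonneg a5 e1) e1) e3) bl,
    mul_nonneg (mul_nonneg (mul_nonneg a5 e1) e1) e2,
    mul_nonneg (mul_nonneg (mul_nonneg (mul_nonneg a4 e3) e5) e5) bl,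
    mul_nonneg (mul_nonneg (mul_nonneg a4 e3) e3) e5,
    mul_nonneg (mul_nonneg (mul_nonneg (mul_nonneg a4 e3) e3) e5) bl,
    mul_nonneg (mul_nonneg (mul_nonneg (mul_nonneg a4 e2) e3) e5) bl,
    mul_nonneg (mul_nonneg (mul_nonneg (mul_nonneg (mul_nonneg a4 e2) e3) e5) bl) s2,
    mul_nonneg (mul_nonneg (mul_nonneg (mul_nonneg (mul_nonneg a4 e2) e3) e5) bl) bl,
    mul_nonneg (mul_nonneg (mul_nonneg (mul_nonneg a4 e2) e3) e3) bl,
    mul_nonneg (mul_nonneg (mul_nonneg (mul_nonneg a4 e2) e2) e5) bl,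
    mul_nonneg (mul_nonneg (mul_nonneg a4 e2) e2) e3,
    mul_nonneg (mul_nonneg (mul_nonneg (mul_nonneg a4 e2) e2) e3) bl,
    mul_nonneg (mul_nonneg (mul_nonneg a4 e1) e5) e5,
    mul_nonneg (mul_nonneg (mul_nonneg (mul_nonneg a4 e1) e5) e5) bl,
    mul_nonneg (mul_nonneg (mul_nonneg (mul_nonneg a4 e1) e3) e5) s2,
    mul_nonneg (mul_nonneg (mul_nonneg (mul_nonneg (mul_nonneg a4 e1) e3) e5) bl) bl,
    mul_nonneg (mul_nonneg (mul_nonneg (mul_nonneg a4 e1) e2) e5) s2,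
    mul_nonneg (mul_nonneg (mul_nonneg (mul_nonneg a4 e1) e2) e5) bl,
    mul_nonneg (mul_nonneg (mul_nonneg a4 e1) e1) e5,
    mul_nonneg (mul_nonneg (mul_nonneg (mul_nonneg a4 e1) e1) e5) bl,
    mul_nonneg (mul_nonneg (mul_nonneg a4 e1) e1) e3,
    mul_nonneg (mul_nonneg (mul_nonneg a4 e1) e1) e2,
    mul_nonneg (mul_nonneg (mul_nonneg (mul_nonneg a4 a5) e2) e3) e3,
    mul_nonneg (mul_nonneg (mul_nonneg (mul_nonneg a4 a5) e2) e2) e3,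
    mul_nonneg (mul_nonneg (mul_nonneg (mul_nonneg (mul_nonneg a4 a5) e1) e2) e3) bl,
    mul_nonneg (mul_nonneg (mul_nonneg (mul_nonneg a4 a5) e1) e1) e3,
    mul_nonneg (mul_nonneg (mul_nonneg (mul_nonneg (mul_nonneg a4 a5) a5) e1) e2) e3,
    mul_nonneg (mul_nonneg (mul_nonneg (mul_nonneg (mul_nonneg a4 a4) a5) e1) e2) e3,
    mul_nonneg (mul_nonneg (mul_nonneg a3 e4) e5) e5,
    mul_nonneg (mul_nonneg (mul_nonneg (mul_nonneg a3 e4) e5) e5) bl,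
    mul_nonneg (mul_nonneg (mul_nonneg a3 e4) e4) e5,
    mul_nonneg (mul_nonneg (mul_nonneg (mul_nonneg a3 e2) e5) e5) bl,
    mul_nonneg (mul_nonneg (mul_nonneg (mul_nonneg a3 e2) e4) e5) s2,
    mul_nonneg (mul_nonneg (mul_nonneg (mul_nonneg (mul_nonneg a3 e2) e4) e5) bl) bl,
    mul_nonneg (mul_nonneg (mul_nonneg a3 e2) e4) e4,
    mul_nonneg (mul_nonneg (mul_nonneg (mul_nonneg a3 e2) e4) e4) bl,
    mul_nonneg (mul_nonneg (mul_nonneg (mul_nonneg a3 e2) e2) e5) bl,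
    mul_nonneg (mul_nonneg (mul_nonneg (mul_nonneg a3 e2) e2) e4) bl,
    mul_nonneg (mul_nonneg (mul_nonneg (mul_nonneg (mul_nonneg a3 e1) e4) e5) bl) s2,
    mul_nonneg (mul_nonneg (mul_nonneg (mul_nonneg (mul_nonneg a3 e1) e4) e5) bl) bl,
    mul_nonneg (mul_nonneg (mul_nonneg a3 e1) e4) e4,
    mul_nonneg (mul_nonneg (mul_nonneg (mul_nonneg a3 e1) e2) e5) s2,
    mul_nonneg (mul_nonneg (mul_nonneg (mul_nonneg (mul_nonneg a3 e1) e2) e5) bl) s2,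
    mul_nonneg (mul_nonneg (mul_nonneg (mul_nonneg (mul_nonneg a3 e1) e2) e5) bl) bl,
    mul_nonneg (mul_nonneg (mul_nonneg (mul_nonneg a3 e1) e2) e4) bl,
    mul_nonneg (mul_nonneg (mul_nonneg (mul_nonneg (mul_nonneg a3 e1) e2) e4) bl) bl,
    mul_nonneg (mul_nonneg (mul_nonneg a3 e1) e2) e2,
    mul_nonneg (mul_nonneg (mul_nonneg (mul_nonneg a3 e1) e2) e2) bl,
    mul_nonneg (mul_nonneg (mul_nonneg a3 e1) e1) e2,
    mul_nonneg (mul_nonneg (mul_nonneg (mul_nonneg a3 a5) e2) e4) e4,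
    mul_nonneg (mul_nonneg (mul_nonneg (mul_nonneg a3 a5) e2) e2) e4,
    mul_nonneg (mul_nonneg (mul_nonneg (mul_nonneg a3 a5) e1) e4) e4,
    mul_nonneg (mul_nonneg (mul_nonneg (mul_nonneg (mul_nonneg a3 a5) e1) e2) e4) s2,
    mul_nonneg (mul_nonneg (mul_nonneg (mul_nonneg a3 a5) e1) e1) e4,
    mul_nonneg (mul_nonneg (mul_nonneg (mul_nonneg (mul_nonneg a3 a5) a5) e1) e2) e4,
    mul_nonneg (mul_nonneg (mul_nonneg (mul_nonneg a3 a4) e2) e5) e5,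
    mul_nonneg (mul_nonneg (mul_nonneg (mul_nonneg a3 a4) e2) e2) e5,
    mul_nonneg (mul_nonneg (mul_nonneg (mul_nonneg a3 a4) e1) e5) e5,
    mul_nonneg (mul_nonneg (mul_nonneg (mul_nonneg (mul_nonneg a3 a4) e1) e2) e5) s2,
    mul_nonneg (mul_nonneg (mul_nonneg (mul_nonneg (mul_nonneg a3 a4) e1) e2) e5) bl,
    mul_nonneg (mul_nonneg (mul_nonneg (mul_nonneg a3 a4) e1) e2) e2,
    mul_nonneg (mul_nonneg (mul_nonneg (mul_nonneg a3 a4) e1) e1) e5,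
    mul_nonneg (mul_nonneg (mul_nonneg (mul_nonneg (mul_nonneg a3 a4) a4) e1) e2) e5,
    mul_nonneg (mul_nonneg (mul_nonneg (mul_nonneg (mul_nonneg a3 a3) a5) e1) e2) e4,
    mul_nonneg (mul_nonneg (mul_nonneg (mul_nonneg (mul_nonneg a3 a3) a4) e1) e2) e5,
    mul_nonneg (mul_nonneg (mul_nonneg a2 e4) e5) e5,
    mul_nonneg (mul_nonneg (mul_nonneg a2 e4) e4) e5,
    mul_nonneg (mul_nonneg (mul_nonneg a2 e3) e5) e5,
    mul_nonneg (mul_nonneg (mul_nonneg a2 e3) e4) e4,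
    mul_nonneg (mul_nonneg (mul_nonneg (mul_nonneg a2 e3) e4) e4) bl,
    mul_nonneg (mul_nonneg (mul_nonneg (mul_nonneg a2 e3) e3) e5) bl,
    mul_nonneg (mul_nonneg (mul_nonneg (mul_nonneg a2 e3) e3) e4) bl,
    mul_nonneg (mul_nonneg (mul_nonneg (mul_nonneg a2 e1) e4) e5) s2,
    mul_nonneg (mul_nonneg (mul_nonneg (mul_nonneg (mul_nonneg a2 e1) e4) e5) bl) s2,
    mul_nonneg (mul_nonneg (mul_nonneg (mul_nonneg (mul_nonneg a2 e1) e4) e5) bl) bl,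
    mul_nonneg (mul_nonneg (mul_nonneg a2 e1) e4) e4,
    mul_nonneg (mul_nonneg (mul_nonneg (mul_nonneg a2 e1) e3) e5) bl,
    mul_nonneg (mul_nonneg (mul_nonneg (mul_nonneg a2 e1) e3) e4) s2,
    mul_nonneg (mul_nonneg (mul_nonneg (mul_nonneg (mul_nonneg a2 e1) e3) e4) bl) s2,
    mul_nonneg (mul_nonneg (mul_nonneg (mul_nonneg (mul_nonneg a2 e1) e3) e4) bl) bl,
    mul_nonneg (mul_nonneg (mul_nonneg a2 e1) e3) e3,
    mul_nonneg (mul_nonneg (mul_nonneg (mul_nonneg a2 e1) e3) e3) bl,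
    mul_nonneg (mul_nonneg (mul_nonneg a2 e1) e1) e5,
    mul_nonneg (mul_nonneg (mul_nonneg (mul_nonneg a2 e1) e1) e5) bl,
    mul_nonneg (mul_nonneg (mul_nonneg (mul_nonneg a2 e1) e1) e4) bl,
    mul_nonneg (mul_nonneg (mul_nonneg (mul_nonneg a2 e1) e1) e3) bl,
    mul_nonneg (mul_nonneg (mul_nonneg (mul_nonneg a2 a5) e1) e4) e4,
    mul_nonneg (mul_nonneg (mul_nonneg (mul_nonneg (mul_nonneg a2 a5) e1) e3) e4) s2,
    mul_nonneg (mul_nonneg (mul_nonneg (mul_nonneg (mul_nonneg a2 a5) e1) e3) e4) bl,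
    mul_nonneg (mul_nonneg (mul_nonneg (mul_nonneg a2 a5) e1) e3) e3,
    mul_nonneg (mul_nonneg (mul_nonneg (mul_nonneg a2 a5) e1) e1) e4,
    mul_nonneg (mul_nonneg (mul_nonneg (mul_nonneg a2 a5) e1) e1) e3,
    mul_nonneg (mul_nonneg (mul_nonneg (mul_nonneg (mul_nonneg a2 a5) a5) e1) e3) e4,
    mul_nonneg (mul_nonneg (mul_nonneg (mul_nonneg a2 a4) e3) e5) e5,
    mul_nonneg (mul_nonneg (mul_nonneg (mul_nonneg a2 a4) e3) e3) e5,
    mul_nonneg (mul_nonneg (mul_nonneg (mul_nonneg (mul_nonneg a2 a4) e1) e3) e5) bl,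
    mul_nonneg (mul_nonneg (mul_nonneg (mul_nonneg a2 a4) e1) e3) e3,
    mul_nonneg (mul_nonneg (mul_nonneg (mul_nonneg a2 a4) e1) e1) e5,
    mul_nonneg (mul_nonneg (mul_nonneg (mul_nonneg a2 a4) e1) e1) e3,
    mul_nonneg (mul_nonneg (mul_nonneg (mul_nonneg (mul_nonneg a2 a4) a4) e1) e3) e5,
    mul_nonneg (mul_nonneg (mul_nonneg (mul_nonneg a2 a3) e1) e5) e5,
    mul_nonneg (mul_nonneg (mul_nonneg (mul_nonneg (mul_nonneg a2 a3) e1) e4) e5) bl,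
    mul_nonneg (mul_nonneg (mul_nonneg (mul_nonneg a2 a3) e1) e4) e4,
    mul_nonneg (mul_nonneg (mul_nonneg (mul_nonneg a2 a3) e1) e1) e4,
    mul_nonneg (mul_nonneg (mul_nonneg (mul_nonneg (mul_nonneg a2 a3) a3) e1) e4) e5,
    mul_nonneg (mul_nonneg (mul_nonneg (mul_nonneg (mul_nonneg a2 a2) a5) e1) e3) e4,
    mul_nonneg (mul_nonneg (mul_nonneg (mul_nonneg (mul_nonneg a2 a2) a4) e1) e3) e5,
    mul_nonneg (mul_nonneg (mul_nonneg (mul_nonneg (mul_nonneg a2 a2) a3) e1) e4) e5,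
    mul_nonneg (mul_nonneg (mul_nonneg a1 e4) e5) e5,
    mul_nonneg (mul_nonneg (mul_nonneg (mul_nonneg a1 e4) e5) e5) bl,
    mul_nonneg (mul_nonneg (mul_nonneg a1 e4) e4) e5,
    mul_nonneg (mul_nonneg (mul_nonneg (mul_nonneg a1 e4) e4) e5) bl,
    mul_nonneg (mul_nonneg (mul_nonneg (mul_nonneg a1 e3) e5) e5) bl,
    mul_nonneg (mul_nonneg (mul_nonneg (mul_nonneg (mul_nonneg a1 e3) e4) e5) bl) s2,
    mul_nonneg (mul_nonneg (mul_nonneg (mul_nonneg (mul_nonneg a1 e3) e4) e5) bl) bl,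
    mul_nonneg (mul_nonneg (mul_nonneg a1 e3) e3) e5,
    mul_nonneg (mul_nonneg (mul_nonneg a1 e3) e3) e4,
    mul_nonneg (mul_nonneg (mul_nonneg (mul_nonneg a1 e2) e5) e5) bl,
    mul_nonneg (mul_nonneg (mul_nonneg (mul_nonneg (mul_nonneg a1 e2) e4) e5) bl) bl,
    mul_nonneg (mul_nonneg (mul_nonneg (mul_nonneg a1 e2) e3) e5) s2,
    mul_nonneg (mul_nonneg (mul_nonneg (mul_nonneg a1 e2) e3) e5) bl,
    mul_nonneg (mul_nonneg (mul_nonneg (mul_nonneg a1 e2) e3) e4) s2,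
    mul_nonneg (mul_nonneg (mul_nonneg (mul_nonneg (mul_nonneg a1 e2) e3) e4) bl) bl,
    mul_nonneg (mul_nonneg (mul_nonneg a1 e2) e2) e5,
    mul_nonneg (mul_nonneg (mul_nonneg (mul_nonneg a1 e2) e2) e5) bl,
    mul_nonneg (mul_nonneg (mul_nonneg a1 e2) e2) e4,
    mul_nonneg (mul_nonneg (mul_nonneg a1 e2) e2) e3,
    mul_nonneg (mul_nonneg (mul_nonneg (mul_nonneg a1 e2) e2) e3) bl,
    mul_nonneg (mul_nonneg (mul_nonneg (mul_nonneg a1 a5) e3) e4) e4,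
    mul_nonneg (mul_nonneg (mul_nonneg (mul_nonneg a1 a5) e3) e3) e4,
    mul_nonneg (mul_nonneg (mul_nonneg (mul_nonneg a1 a5) e2) e4) e4,
    mul_nonneg (mul_nonneg (mul_nonneg (mul_nonneg (mul_nonneg a1 a5) e2) e3) e4) s2,
    mul_nonneg (mul_nonneg (mul_nonneg (mul_nonneg (mul_nonneg a1 a5) e2) e3) e4) bl,
    mul_nonneg (mul_nonneg (mul_nonneg (mul_nonneg a1 a5) e2) e3) e3,
    mul_nonneg (mul_nonneg (mul_nonneg (mul_nonneg a1 a5) e2) e2) e4,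
    mul_nonneg (mul_nonneg (mul_nonneg (mul_nonneg (mul_nonneg a1 a5) a5) e2) e3) e4,
    mul_nonneg (mul_nonneg (mul_nonneg (mul_nonneg a1 a4) e3) e5) e5,
    mul_nonneg (mul_nonneg (mul_nonneg (mul_nonneg a1 a4) e3) e3) e5,
    mul_nonneg (mul_nonneg (mul_nonneg (mul_nonneg a1 a4) e2) e5) e5,
    mul_nonneg (mul_nonneg (mul_nonneg (mul_nonneg a1 a4) e2) e2) e3,
    mul_nonneg (mul_nonneg (mul_nonneg (mul_nonneg (mul_nonneg a1 a4) a4) e2) e3) e5,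
    mul_nonneg (mul_nonneg (mul_nonneg (mul_nonneg a1 a3) e4) e5) e5,
    mul_nonneg (mul_nonneg (mul_nonneg (mul_nonneg a1 a3) e4) e4) e5,
    mul_nonneg (mul_nonneg (mul_nonneg (mul_nonneg (mul_nonneg a1 a3) e2) e4) e5) bl,
    mul_nonneg (mul_nonneg (mul_nonneg (mul_nonneg a1 a3) e2) e4) e4,
    mul_nonneg (mul_nonneg (mul_nonneg (mul_nonneg a1 a3) e2) e2) e5,
    mul_nonneg (mul_nonneg (mul_nonneg (mul_nonneg (mul_nonneg a1 a3) a3) e2) e4) e5,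
    mul_nonneg (mul_nonneg (mul_nonneg (mul_nonneg a1 a2) e4) e5) e5,
    mul_nonneg (mul_nonneg (mul_nonneg (mul_nonneg a1 a2) e4) e4) e5,
    mul_nonneg (mul_nonneg (mul_nonneg (mul_nonneg a1 a2) e3) e5) e5,
    mul_nonneg (mul_nonneg (mul_nonneg (mul_nonneg (mul_nonneg a1 a2) e3) e4) e5) s2,
    mul_nonneg (mul_nonneg (mul_nonneg (mul_nonneg (mul_nonneg a1 a2) e3) e4) e5) bl,
    mul_nonneg (mul_nonneg (mul_nonneg (mul_nonneg a1 a2) e3) e3) e4,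
    mul_nonneg (mul_nonneg (mul_nonneg (mul_nonneg (mul_nonneg a1 a2) a2) e3) e4) e5,
    mul_nonneg (mul_nonneg (mul_nonneg (mul_nonneg (mul_nonneg a1 a1) a5) e2) e3) e4,
    mul_nonneg (mul_nonneg (mul_nonneg (mul_nonneg (mul_nonneg a1 a1) a4) e2) e3) e5,
    mul_nonneg (mul_nonneg (mul_nonneg (mul_nonneg (mul_nonneg a1 a1) a3) e2) e4) e5,
    mul_nonneg (mul_nonneg (mul_nonneg (mul_nonneg (mul_nonneg a1 a1) a2) e3) e4) e5]


end LawDec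
end Quant
end Summit.CriticalPhenomena.PercolationContinuityZ3.Theorems
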